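import Summits.QuantumFields.YangMills.Theorems.GronwallGapAnalyticDetourBypassExact

/-!
# Crux `AnalyticDetour` (stmt-QuantumFields-8801), line `registered`:
# canonical form of stub A — the Gateaux-singular Wilson set is locally finite

Route `GronwallGap`, sub-problem `YangMills`.  Stub A of the cycle-3 skeleton
(`stub_axisRegularOffLocallyFinite`) asks for SOME set `E ⊂ ℝ`, locally finite on `[0, ∞)`, off
which every Wilson weight `exp(β Re tr r.ρ)`, `β > 0`, has Gateaux-analytic torus pressure
(`AnP`).  The existential is spurious: the statement is equivalent to local finiteness of the
CANONICAL exceptional set, the Gateaux-singular Wilson couplings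
`S(r) = {β > 0 : ¬ AnP (exp(β Re tr r.ρ))}` — this is the form in which the conjecture should be
filed and shared ("the bulk singularities of the 4D Wilson theory of `r`, in the Gateaux sense,
are isolated in `[0, ∞)`"; for `SU(2)`, `SU(3)` fundamental the lore is `S = ∅`, for the
narrow-well representations of `SU(2)` `S ≠ ∅` modulo van Enter–Shlosman, p172139).  Combined with
`analyticDetour_iff_bypass` it gives the crux as "`S(r)` locally finite ∧ local bypass".

Pure logic; no named facts; no definitions.
-/

noncomputable section

namespace Summit.QuantumFields.YangMills.Theorems

open scoped BigOperators

/-- **Stub A in canonical form.**  `stub_axisRegularOffLocallyFinite` (verbatim as registered) holds iff for every compact simple `G` and lattice representation `r` the set of Gateaux-SINGULAR Wilson couplings `{β > 0 : ¬ AnP (exp(β Re tr r.ρ))}` meets every `[0, b]` in a finite set (`→`: the singular set lies inside any admissible `E`; `←`: take `E` to be the singular set itself). -/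
theorem axisRegularOffLocallyFinite_iff_singularSetLocallyFinite :
    (∀ (G : Type) [Group G] [TopologicalSpace G] [IsTopologicalGroup G] [CompactSpace G], Literature.MathematicalPhysics.QuantumFieldTheory.IsCompactSimpleLieGroup G → letI : MeasurableSpace G := borel G; haveI : BorelSpace G := ⟨rfl⟩; let Pseq : (G → ℝ) → ℕ → ℝ := fun v L => (((L + 1 : ℕ) : ℝ) ^ 4)⁻¹ * Real.log (((MeasureTheory.Measure.pi fun _ : Literature.MathematicalPhysics.QuantumFieldTheory.Edge 4 (L + 1) => Literature.MathematicalPhysics.QuantumFieldTheory.haarProbability G).withDensity (fun U : Literature.MathematicalPhysics.QuantumFieldTheory.GaugeConfig 4 (L + 1) G => ENNReal.ofReal (Literature.MathematicalPhysics.QuantumLattice.groupHeatKernelWeight (fun _ : ℝ => v) 0 U))) Set.univ).toReal; let AnP : (G → ℝ) → Prop := fun v => ∀ φ : G → ℝ, Continuous φ → (∀ g h : G, φ (h * g * h⁻¹) = φ g) → ∃ p : ℝ → ℝ, (∀ t : ℝ, Filter.Tendsto (fun L : ℕ => Pseq (fun g => v g * Real.exp (t * φ g)) L) Filter.atTop (nhds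 (p t))) ∧ AnalyticAt ℝ p 0; ∀ r : Literature.MathematicalPhysics.QuantumFieldTheory.LatticeRep G, ∃ E : Set ℝ, (∀ b : ℝ, (E ∩ Set.Icc 0 b).Finite) ∧ ∀ β : ℝ, 0 < β → β ∉ E → AnP (fun g => Real.exp (β * (r.ρ g).trace.re))) ↔
    (∀ (G : Type) [Group G] [TopologicalSpace G] [IsTopologicalGroup G] [CompactSpace G], Literature.MathematicalPhysics.QuantumFieldTheory.IsCompactSimpleLieGroup G → letI : MeasurableSpace G := borel G; haveI : BorelSpace G := ⟨rfl⟩; let Pseq : (G → ℝ) → ℕ → ℝ := fun v L => (((L + 1 : ℕ) : ℝ) ^ 4)⁻¹ * Real.log (((MeasureTheory.Measure.pi fun _ : Literature.MathematicalPhysics.QuantumFieldTheory.Edge 4 (L + 1) => Literature.MathematicalPhysics.QuantumFieldTheory.haarProbability G).withDensity (fun U : Literature.MathematicalPhysics.QuantumFieldTheory.GaugeConfig 4 (L + 1) G => ENNReal.ofReal (Literature.MathematicalPhysics.QuantumLattice.groupHeatKernelWeight (fun _ : ℝ => v) 0 U))) Set.univ).toReal; let AnP : (G → ℝ) → Prop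 := fun v => ∀ φ : G → ℝ, Continuous φ → (∀ g h : G, φ (h * g * h⁻¹) = φ g) → ∃ p : ℝ → ℝ, (∀ t : ℝ, Filter.Tendsto (fun L : ℕ => Pseq (fun g => v g * Real.exp (t * φ g)) L) Filter.atTop (nhds (p t))) ∧ AnalyticAt ℝ p 0; ∀ r : Literature.MathematicalPhysics.QuantumFieldTheory.LatticeRep G, ∀ b : ℝ, ({β : ℝ | 0 < β ∧ ¬ AnP (fun g => Real.exp (β * (r.ρ g).trace.re))} ∩ Set.Icc 0 b).Finite) := by
  constructor
  · intro hA G i1 i2 i3 i4 hG Pseq AnP r b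
    obtain ⟨E, hE, hreg⟩ := hA G hG r
    refine (hE b).subset ?_
    rintro β ⟨⟨hβ, hsing⟩, hβb⟩
    refine ⟨?_, hβb⟩
    by_contra hβE
    exact hsing (hreg β hβ hβE)
  · intro hS G i1 i2 i3 i4 hG Pseq AnP r
    refine ⟨{β : ℝ | 0 < β ∧ ¬ AnP (fun g => Real.exp (β * (r.ρ g).trace.re))}, hS G hG r,
      fun β hβ hβE => ?_⟩
    by_contra hsing
    exact hβE ⟨hβ, hsing⟩

/-- **The crux in canonical form.**  `AnalyticDetour` holds iff, for every compact simple `G` and lattice representation `r`, (i) the Gateaux-singular Wilson couplings are locally finite on `[0, ∞)` and (ii) the local bypass property `stub_localBypass` holds (`analyticDetour_iff_bypass` rewritten through `axisRegularOffLocallyFinite_iff_singularSetLocallyFinite`). -/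
theorem analyticDetour_iff_singularSetLocallyFinite_and_localBypass :
    Summit.QuantumFields.YangMills.Theses.GronwallGap.AnalyticDetour ↔
    ((∀ (G : Type) [Group G] [TopologicalSpace G] [IsTopologicalGroup G] [CompactSpace G], Literature.MathematicalPhysics.QuantumFieldTheory.IsCompactSimpleLieGroup G → letI : MeasurableSpace G := borel G; haveI : BorelSpace G := ⟨rfl⟩; let Pseq : (G → ℝ) → ℕ → ℝ := fun v L => (((L + 1 : ℕ) : ℝ) ^ 4)⁻¹ * Real.log (((MeasureTheory.Measure.pi fun _ : Literature.MathematicalPhysics.QuantumFieldTheory.Edge 4 (L + 1) => Literature.MathematicalPhysics.QuantumFieldTheory.haarProbability G).withDensity (fun U : Literature.MathematicalPhysics.QuantumFieldTheory.GaugeConfig 4 (L + 1) G => ENNReal.ofReal (Literature.MathematicalPhysics.QuantumLattice.groupHeatKernelWeight (fun _ : ℝ => v) 0 U))) Set.univ).toReal; let AnP : (G → ℝ) → Prop := fun v => ∀ φ : G → ℝ, Continuous φ → (∀ g h : G, φ (h * g * h⁻¹) = φ g) → ∃ p : ℝ → ℝ, (∀ t : ℝ, Filter.Tendsto (fun L :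 ℕ => Pseq (fun g => v g * Real.exp (t * φ g)) L) Filter.atTop (nhds (p t))) ∧ AnalyticAt ℝ p 0; ∀ r : Literature.MathematicalPhysics.QuantumFieldTheory.LatticeRep G, ∀ b : ℝ, ({β : ℝ | 0 < β ∧ ¬ AnP (fun g => Real.exp (β * (r.ρ g).trace.re))} ∩ Set.Icc 0 b).Finite) ∧
     (∀ (G : Type) [Group G] [TopologicalSpace G] [IsTopologicalGroup G] [CompactSpace G], Literature.MathematicalPhysics.QuantumFieldTheory.IsCompactSimpleLieGroup G → letI : MeasurableSpace G := borel G; haveI : BorelSpace G := ⟨rfl⟩; let Pseq : (G → ℝ) → ℕ → ℝ := fun v L => (((L + 1 : ℕ) : ℝ) ^ 4)⁻¹ * Real.log (((MeasureTheory.Measure.pi fun _ : Literature.MathematicalPhysics.QuantumFieldTheory.Edge 4 (L + 1) => Literature.MathematicalPhysics.QuantumFieldTheory.haarProbability G).withDensity (fun U : Literature.MathematicalPhysics.QuantumFieldTheory.GaugeConfig 4 (L + 1) G => ENNReal.ofReal (Literature.MathematicalPhysics.QuantumLattice.groupHeatKernelWeight (fun _ : ℝ => v) 0 U))) Set.univ).toReal;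 let AnP : (G → ℝ) → Prop := fun v => ∀ φ : G → ℝ, Continuous φ → (∀ g h : G, φ (h * g * h⁻¹) = φ g) → ∃ p : ℝ → ℝ, (∀ t : ℝ, Filter.Tendsto (fun L : ℕ => Pseq (fun g => v g * Real.exp (t * φ g)) L) Filter.atTop (nhds (p t))) ∧ AnalyticAt ℝ p 0; let Adm : (ℝ → G → ℝ) → Prop := fun w => (∀ s ∈ Set.Icc (0 : ℝ) 1, Continuous (w s) ∧ (∀ g : G, 0 < w s g) ∧ (∀ g h : G, w s (h * g * h⁻¹) = w s g) ∧ (∀ g : G, w s g⁻¹ = w s g) ∧ (∀ (n : ℕ) (x : Fin n → G) (c : Fin n → ℂ), 0 ≤ (∑ i, ∑ j, (starRingEnd ℂ) (c i) * c j * ((w s ((x i)⁻¹ * x j) : ℝ) : ℂ)).re)) ∧ ∃ Λ : ℝ, ∀ s ∈ Set.Icc (0 : ℝ) 1, ∀ s' ∈ Set.Icc (0 : ℝ) 1, ∀ g : G, |Real.log (w s g) - Real.log (w s' g)| ≤ Λ * |s - s'|; ∀ r : Literature.MathematicalPhysics.QuantumFieldTheory.LatticeRep G, ∀ βc : ℝ,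 0 < βc → ∃ δ : ℝ, 0 < δ ∧ ∀ βm ∈ Set.Ioo (βc - δ) βc, ∀ βp ∈ Set.Ioo βc (βc + δ), 0 < βm → AnP (fun g => Real.exp (βm * (r.ρ g).trace.re)) → AnP (fun g => Real.exp (βp * (r.ρ g).trace.re)) → ∃ w : ℝ → G → ℝ, Adm w ∧ (∀ s ∈ Set.Icc (0 : ℝ) 1, AnP (w s)) ∧ w 0 = (fun g => Real.exp (βm * (r.ρ g).trace.re)) ∧ w 1 = (fun g => Real.exp (βp * (r.ρ g).trace.re)))) := by
  rw [analyticDetour_iff_bypass, axisRegularOffLocallyFinite_iff_singularSetLocallyFinite]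

end Summit.QuantumFields.YangMills.Theorems

end
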